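import Summits.HubbardSuperconductivity.HubbardSuperconductivity.Theorems.AnisotropyChordTransferFibre3RingShift
import Summits.HubbardSuperconductivity.HubbardSuperconductivity.Theorems.AnisotropyChordTransferFibre3Fourier

/-!
# Route `AnisotropyChord` / H0 rotor rung: PartN37 — the SHIFTED RING RESOLVENT SUM, trigonometric continuation `RingResolventSumShiftTrig` PROVED

Proof of the exact one-dimensional identity typed in the PORT of the theory seat's PartN37 (`…Fibre3KernelWindow`,
prover seat `hubbard-h0-rotor-p2` g0, p739260), companion of the hyperbolic `RingResolventSumShift`
(`ringResolventSumShift_holds`, `…Fibre3RingShift`, prover seat `hubbard-h0-rotor-p1` g23, p742210):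

* `ringResolventSumShiftTrig_holds : RingResolventSumShiftTrig L` — for `sin α ≠ 0` and `cos(Lα) ≠ cos(Lφ)`,
  `Σ_{j ∈ ℤ/L} 1/(cos α − cos(2πj/L + φ)) = L sin(Lα) / (sin α (cos(Lα) − cos(Lφ)))`, every `L ≥ 1`
  (the typed extra hypothesis «no denominator vanishes» is implied by `cos(Lα) ≠ cos(Lφ)` and not used).

Method (one abstract lemma over `ℂ`, `shifted_resolvent_abstract`, which covers the hyperbolic case `a = e^{μ}` as well):
the twisted roots `ζ_j = e^{i(2πj/L + φ)}` are the `L` roots of `z^L = ω := e^{iLφ}`; for `a^L ≠ ω` the finite geometric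
sum `(Σ_{n<L} ζ_j^n a^{L−1−n})(ζ_j − a) = ω − a^L` (`geom_sum₂_mul`) and the character sums `Σ_j ζ_j^n = L·[n = 0]`
(`0 ≤ n < L`, `sum_phZ_mul`) give the ROOT SUM `Σ_j 1/(ζ_j − a) = L a^{L−1}/(ω − a^L)` (`sum_inv_root_sub`); partial
fractions of `1/((a + a⁻¹)/2 − (ζ + ζ⁻¹)/2) = −2ζ/((ζ − a)(ζ − a⁻¹))` and `a^L · a^{−L} = 1` finish; the statement is the
specialisation `a = e^{iα}` (`a^L ≠ ω ≠ a^{−L}` because their real parts are `cos(Lα) ≠ cos(Lφ)`).  No series, no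
hypothesis added.  These inner sums are the sub-threshold rows of the O(L) DIAGONAL ROW FORMULA (`DiagRotation`, PartN37)
for the kernel window of the GM₃ certificate / HOLE₂ Birman–Schwinger matrix (memo ROTOR-THEORY-21 §315).
Prover seat `hubbard-h0-rotor-p3` g2; helper for stmt-HubbardSuperconductivity-19089 (`--supports`, helper class).
Nothing here proves superconductivity in the Hubbard model; these are helper lemmas of ONE conditional reduction
(rung 19089); the rotor TARGET as originally worded stays FALSE (g15 verdict).  Mathlib + the tree only; no sorry.
-/

set_option linter.dupNamespace false
set_option autoImplicit false

noncomputable section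

open scoped BigOperators
open Complex

namespace Summit.HubbardSuperconductivity.HubbardSuperconductivity.Theorems.AnisotropyChord.Transfer.Fibre3

variable (L : ℕ) [NeZero L]

/-! ## Twisted roots of unity

The twisted roots are `ζ_j = e^{i(2πj/L + φ)}` and `ω = e^{iLφ}`; to keep this file free of auxiliary definitions they are
written out, and the algebra is done for an abstract family `z : ZMod L → ℂ` with `z_j^L = ω` and the character sums
`Σ_j z_j^n = L·[n = 0]` (`0 ≤ n < L`). -/

omit [NeZero L] in
/-- `ζ_j = e(j) · e^{iφ}`. [folklore] -/
theorem twist_eq_phZ_mul (φ : ℝ) (j : ZMod L) :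
    Complex.exp (((2 * Real.pi * j.val / L + φ : ℝ) : ℂ) * I) = phZ L j * Complex.exp ((φ : ℂ) * I) := by
  unfold phZ
  rw [← Complex.exp_add]
  congr 1
  push_cast
  ring

/-- `ζ_j^n = e(j·n) · e^{inφ}`. [folklore] -/
theorem twist_pow (φ : ℝ) (j : ZMod L) (n : ℕ) :
    Complex.exp (((2 * Real.pi * j.val / L + φ : ℝ) : ℂ) * I) ^ n
      = phZ L (j * (n : ZMod L)) * Complex.exp ((n : ℂ) * ((φ : ℂ) * I)) := by
  rw [twist_eq_phZ_mul, mul_pow, phZ_pow, mul_comm ((n : ℕ) : ZMod L) j, Complex.exp_nat_mul]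

/-- `ζ_j^L = ω = e^{iLφ}` for every `j`. [folklore] -/
theorem twist_pow_L (φ : ℝ) (j : ZMod L) :
    Complex.exp (((2 * Real.pi * j.val / L + φ : ℝ) : ℂ) * I) ^ L = Complex.exp ((((L : ℝ) * φ : ℝ) : ℂ) * I) := by
  rw [twist_pow, ZMod.natCast_self, mul_zero, phZ_zero, one_mul]
  congr 1
  push_cast
  ring

/-- character sums of the twisted roots: `Σ_j ζ_j^n = L·[n = 0]` for `0 ≤ n < L`. [folklore] -/
theorem sum_twist_pow (φ : ℝ) (n : ℕ) (hn : n < L) :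
    ∑ j : ZMod L, Complex.exp (((2 * Real.pi * j.val / L + φ : ℝ) : ℂ) * I) ^ n
      = if n = 0 then (L : ℂ) else 0 := by
  simp_rw [twist_pow]
  rw [← Finset.sum_mul, sum_phZ_mul L (n : ZMod L)]
  by_cases h0 : n = 0
  · subst h0
    simp
  · have hne : (n : ZMod L) ≠ 0 := by
      rw [Ne, ZMod.natCast_eq_zero_iff]
      exact fun hd => h0 (Nat.eq_zero_of_dvd_of_lt hd hn)
    rw [if_neg hne, if_neg h0, zero_mul]

/-! ## The root sum and the abstract shifted resolvent -/

/-- **ROOT SUM:** if `z_j^L = ω` for all `j`, `Σ_j z_j^n = L·[n = 0]` for `n < L`, and `a^L ≠ ω`, then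
`Σ_j 1/(z_j − a) = L a^{L−1}/(ω − a^L)`. [folklore] -/
theorem sum_inv_root_sub (z : ZMod L → ℂ) (ω a : ℂ) (hzL : ∀ j, z j ^ L = ω)
    (hsum : ∀ n : ℕ, n < L → ∑ j : ZMod L, z j ^ n = if n = 0 then (L : ℂ) else 0) (ha : a ^ L ≠ ω) :
    ∑ j : ZMod L, 1 / (z j - a) = (L : ℂ) * a ^ (L - 1) / (ω - a ^ L) := by
  have hL : 0 < L := NeZero.pos L
  have hden : ω - a ^ L ≠ 0 := sub_ne_zero.mpr (Ne.symm ha)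
  have hterm : ∀ j : ZMod L, 1 / (z j - a)
      = (∑ i ∈ Finset.range L, z j ^ i * a ^ (L - 1 - i)) / (ω - a ^ L) := by
    intro j
    have hz : z j - a ≠ 0 := by
      intro h
      apply ha
      rw [← sub_eq_zero.mp h, hzL]
    have key := geom_sum₂_mul (z j) a L
    rw [hzL] at key
    rw [div_eq_div_iff hz hden, one_mul]
    exact key.symm
  rw [Finset.sum_congr rfl fun j _ => hterm j, ← Finset.sum_div]
  congr 1
  rw [Finset.sum_comm]
  have inner : ∀ i ∈ Finset.range L, ∑ j : ZMod L, z j ^ i * a ^ (L - 1 - i)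
      = if i = 0 then (L : ℂ) * a ^ (L - 1) else 0 := by
    intro i hi
    rw [← Finset.sum_mul, hsum i (Finset.mem_range.mp hi)]
    split_ifs with h0
    · subst h0
      simp
    · simp
  rw [Finset.sum_congr rfl inner, Finset.sum_ite_eq', if_pos (Finset.mem_range.mpr hL)]

/-- **ABSTRACT SHIFTED RING RESOLVENT:** for a family `z_j ≠ 0` with `z_j^L = ω ≠ 0` and character sums as above,
and `a·b = 1`, `a ≠ b`, `a^L ≠ ω`, `b^L ≠ ω`:
`Σ_j 1/((a + b)/2 − (z_j + z_j⁻¹)/2) = L · ((a^L − b^L)/2) / (((a − b)/2) · ((a^L + b^L)/2 − (ω + ω⁻¹)/2))`.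
[folklore] -/
theorem shifted_resolvent_abstract (z : ZMod L → ℂ) (ω : ℂ) (hz0 : ∀ j, z j ≠ 0) (hω0 : ω ≠ 0)
    (hzL : ∀ j, z j ^ L = ω)
    (hsum : ∀ n : ℕ, n < L → ∑ j : ZMod L, z j ^ n = if n = 0 then (L : ℂ) else 0)
    (a b : ℂ) (hab1 : a * b = 1) (hab : a - b ≠ 0) (hA : a ^ L ≠ ω) (hB : b ^ L ≠ ω) :
    ∑ j : ZMod L, 1 / ((a + b) / 2 - (z j + (z j)⁻¹) / 2)
      = (L : ℂ) * ((a ^ L - b ^ L) / 2)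
          / (((a - b) / 2) * ((a ^ L + b ^ L) / 2 - (ω + ω⁻¹) / 2)) := by
  have hL : 0 < L := NeZero.pos L
  have hωA : ω - a ^ L ≠ 0 := sub_ne_zero.mpr (Ne.symm hA)
  have hωB : ω - b ^ L ≠ 0 := sub_ne_zero.mpr (Ne.symm hB)
  -- pointwise partial fractions
  have hpt : ∀ j : ZMod L, 1 / ((a + b) / 2 - (z j + (z j)⁻¹) / 2)
      = (-2 / (a - b)) * (a * (1 / (z j - a)) - b * (1 / (z j - b))) := by
    intro j
    have hz0j : z j ≠ 0 := hz0 j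
    have hza : z j - a ≠ 0 := by
      intro h
      apply hA
      rw [← sub_eq_zero.mp h, hzL]
    have hzb : z j - b ≠ 0 := by
      intro h
      apply hB
      rw [← sub_eq_zero.mp h, hzL]
    have hden : (a + b) / 2 - (z j + (z j)⁻¹) / 2 = -((z j - a) * (z j - b)) / (2 * z j) := by
      field_simp
      linear_combination hab1
    rw [hden]
    field_simp
    ring
  rw [Finset.sum_congr rfl fun j _ => hpt j, ← Finset.mul_sum, Finset.sum_sub_distrib, ← Finset.mul_sum,
    ← Finset.mul_sum, sum_inv_root_sub L z ω a hzL hsum hA, sum_inv_root_sub L z ω b hzL hsum hB]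
  have hpa : a * ((L : ℂ) * a ^ (L - 1) / (ω - a ^ L)) = (L : ℂ) * a ^ L / (ω - a ^ L) := by
    rw [← mul_div_assoc, ← mul_assoc, mul_comm a, mul_assoc, ← pow_succ', Nat.sub_add_cancel hL]
  have hpb : b * ((L : ℂ) * b ^ (L - 1) / (ω - b ^ L)) = (L : ℂ) * b ^ L / (ω - b ^ L) := by
    rw [← mul_div_assoc, ← mul_assoc, mul_comm b, mul_assoc, ← pow_succ', Nat.sub_add_cancel hL]
  rw [hpa, hpb]
  have hprod : a ^ L * b ^ L = 1 := by
    rw [← mul_pow, hab1, one_pow]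
  have htarget : (a ^ L + b ^ L) / 2 - (ω + ω⁻¹) / 2 = -((ω - a ^ L) * (ω - b ^ L)) / (2 * ω) := by
    field_simp
    linear_combination hprod
  rw [htarget]
  field_simp
  ring

/-! ## The imaginary exponential as the parameter `a` -/

/-- `cos x = (e^{ix} + e^{−ix})/2` with `e^{−ix} = (e^{ix})⁻¹`. [folklore] -/
theorem ofReal_cos_eq (x : ℝ) :
    ((Real.cos x : ℝ) : ℂ) = (Complex.exp ((x : ℂ) * I) + (Complex.exp ((x : ℂ) * I))⁻¹) / 2 := by
  rw [Complex.ofReal_cos, ← Complex.exp_neg]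
  have h := Complex.two_cos (x : ℂ)
  rw [neg_mul] at h
  rw [← h]
  ring

/-- `sin x = ((e^{ix})⁻¹ − e^{ix}) · i/2`. [folklore] -/
theorem ofReal_sin_eq (x : ℝ) :
    ((Real.sin x : ℝ) : ℂ) = ((Complex.exp ((x : ℂ) * I))⁻¹ - Complex.exp ((x : ℂ) * I)) * I / 2 := by
  rw [Complex.ofReal_sin, ← Complex.exp_neg]
  have h := Complex.two_sin (x : ℂ)
  rw [neg_mul] at h
  rw [← h]
  ring

/-! ## The typed statement -/

/-- **`RingResolventSumShiftTrig` holds** (PartN37, trigonometric continuation `μ = iα`, every `L ≥ 1`):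
if `sin α ≠ 0` and `cos(Lα) ≠ cos(Lφ)` then `Σ_j 1/(cos α − cos(2πj/L + φ)) = L sin(Lα)/(sin α (cos(Lα) − cos(Lφ)))`
(the typed extra hypothesis that no denominator vanishes is implied and not used). -/
theorem ringResolventSumShiftTrig_holds : RingResolventSumShiftTrig L := by
  intro α φ hsin hcos _
  have hL : 0 < L := NeZero.pos L
  -- the twisted roots and their common `L`-th power
  set z : ZMod L → ℂ := fun j => Complex.exp (((2 * Real.pi * j.val / L + φ : ℝ) : ℂ) * I) with hz_def
  set ω : ℂ := Complex.exp ((((L : ℝ) * φ : ℝ) : ℂ) * I) with hω_def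
  have hz0 : ∀ j, z j ≠ 0 := fun j => Complex.exp_ne_zero _
  have hω0 : ω ≠ 0 := Complex.exp_ne_zero _
  have hzL : ∀ j, z j ^ L = ω := fun j => twist_pow_L L φ j
  have hsum : ∀ n : ℕ, n < L → ∑ j : ZMod L, z j ^ n = if n = 0 then (L : ℂ) else 0 :=
    fun n hn => sum_twist_pow L φ n hn
  have hωre : ω.re = Real.cos (L * φ) := Complex.exp_ofReal_mul_I_re _
  -- the parameter `a = e^{iα}`
  set a : ℂ := Complex.exp ((α : ℂ) * I) with ha_def
  have ha0 : a ≠ 0 := Complex.exp_ne_zero _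
  have hsinC : ((Real.sin α : ℝ) : ℂ) = (a⁻¹ - a) * I / 2 := by rw [ofReal_sin_eq]
  have hab : a - a⁻¹ ≠ 0 := by
    intro h
    apply hsin
    have : ((Real.sin α : ℝ) : ℂ) = 0 := by
      rw [hsinC, show a⁻¹ - a = -(a - a⁻¹) by ring, h]
      simp
    exact_mod_cast this
  have hAre : (a ^ L).re = Real.cos (L * α) := by
    rw [ha_def, ← Complex.exp_nat_mul, show ((L : ℕ) : ℂ) * ((α : ℂ) * I) = (((L : ℝ) * α : ℝ) : ℂ) * I by
      push_cast; ring, Complex.exp_ofReal_mul_I_re]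
  have hBre : (a⁻¹ ^ L).re = Real.cos (L * α) := by
    rw [ha_def, ← Complex.exp_neg, ← Complex.exp_nat_mul,
      show ((L : ℕ) : ℂ) * -((α : ℂ) * I) = (((-((L : ℝ) * α)) : ℝ) : ℂ) * I by push_cast; ring,
      Complex.exp_ofReal_mul_I_re, Real.cos_neg]
  have hA : a ^ L ≠ ω := by
    intro h
    apply hcos
    rw [← hAre, ← hωre, h]
  have hB : a⁻¹ ^ L ≠ ω := by
    intro h
    apply hcos
    rw [← hBre, ← hωre, h]
  have key := shifted_resolvent_abstract L z ω hz0 hω0 hzL hsum a a⁻¹ (mul_inv_cancel₀ ha0) hab hA hB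
  apply Complex.ofReal_injective
  simp only [Complex.ofReal_sum, Complex.ofReal_div, Complex.ofReal_one, Complex.ofReal_sub,
    Complex.ofReal_mul, Complex.ofReal_natCast]
  have lhs : ∀ j : ZMod L, (1 : ℂ) / ((Real.cos α : ℂ) - (Real.cos (2 * Real.pi * j.val / L + φ) : ℂ))
      = 1 / ((a + a⁻¹) / 2 - (z j + (z j)⁻¹) / 2) := by
    intro j
    rw [ofReal_cos_eq, ofReal_cos_eq]
  rw [Finset.sum_congr rfl fun j _ => lhs j, key]
  have e1 : ((Real.sin (L * α) : ℝ) : ℂ) = (a⁻¹ ^ L - a ^ L) * I / 2 := by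
    rw [ofReal_sin_eq, ha_def, inv_pow, ← Complex.exp_nat_mul]
    push_cast
    ring_nf
  have e2 : ((Real.cos (L * α) : ℝ) : ℂ) = (a ^ L + a⁻¹ ^ L) / 2 := by
    rw [ofReal_cos_eq, ha_def, inv_pow, ← Complex.exp_nat_mul]
    push_cast
    ring_nf
  have e4 : ((Real.cos (L * φ) : ℝ) : ℂ) = (ω + ω⁻¹) / 2 := by rw [ofReal_cos_eq]
  rw [e1, e2, hsinC, e4]
  -- both sides agree after cancelling the factor `I` between `sin(Lα)` and `sin α`
  set A : ℂ := a ^ L with hA_def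
  set B : ℂ := a⁻¹ ^ L with hB_def
  set D : ℂ := (A + B) / 2 - (ω + ω⁻¹) / 2 with hD_def
  have hI : (I : ℂ) ≠ 0 := Complex.I_ne_zero
  set b : ℂ := a⁻¹ with hb_def
  have hba : b - a ≠ 0 := by
    rw [show b - a = -(a - b) by ring]
    exact neg_ne_zero.mpr hab
  by_cases hD : D = 0
  · rw [hD]
    simp
  · field_simp
    ring

end Summit.HubbardSuperconductivity.HubbardSuperconductivity.Theorems.AnisotropyChord.Transfer.Fibre3

end
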